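import Summits.Schanuel.Schanuel.Theorems.ZilberEacSuperellipticPolyFibres
import Summits.Schanuel.Schanuel.Theorems.ZilberEacFibrationProj
import HarnessLib

/-!
# Arbitrary base branches, XLI: new unconditional members of `EC(3,2)` — threefolds fibred over the
# cylinders over `x₁^k = P(x₀)` decided in files XXXIV–XXXVII

HONEST FRAMING.  Cell `pub-schanuel` (Zilber's Exponential-Algebraic Closedness, case ladder;
host summit Schanuel), seat 2, gen 29.  Bookkeeping, no new analysis: THEOREM F′ of gen 5
(`inter_expGraph_nonempty_of_unprojectedDense_proj`: an irreducible threefold `W ⊆ ℂ³ × ℂ³`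
meeting `G³`, of dimension `3`, whose torus part is fibred in curves over a surface with
Zariski-dense exponential points, meets `Γ_exp`) applied to this generation's surfaces: constant
fibres over the cyclic covers with `k ≥ 3` (every `θ ≠ 0`), polynomial fibres `y₀ = R(x₀)`,
`y₀ = R(x₁)` over `x₁^k = P(x₀)` (`deg P ≠ k ∨ k ≥ 3`).  Every such `W` meets the graph of `exp` —
unconditional members of the OPEN cell `EC(3,2)` (no freeness / rotundity hypothesis needed).
`EC(3,2)` itself stays OPEN; Mantova–Masser's question is OPEN in general (PLMS 2024 §1 p. 5);
NOT Schanuel's conjecture (neither used nor implied); EAC ⇏ SC.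
-/

noncomputable section

open Filter Topology Set Complex MvPolynomial
open Literature.NumberTheory.Transcendental Literature.ModelTheory.Zilber
open Literature.ModelTheory.ExponentialFields

set_option linter.dupNamespace false

namespace Summit.Schanuel.Schanuel.Theorems

section Superelliptic

variable (P : Polynomial ℂ)

/-- **Members of `EC(3,2)` over constant-fibre cylinders, `k ≥ 3`.**  A threefold `W ⊆ ℂ³ × ℂ³`
(irreducible closed, meeting `G³`, of dimension `3`, torus part fibred in curves) whose projected
surface is `{x₁^k = P(x₀), y₀ = θ}` (`k ≥ 3`, `P` monic of degree `≥ 1` with a simple root,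
`θ ≠ 0`) meets `Γ_exp`. [cite: MantovaMasser2023, §1 Further remarks, p. 5] (new) -/
theorem inter_expGraph_nonempty_of_fibred_over_superelliptic_constFibre {k : ℕ} (hk : 3 ≤ k)
    (hP : P.Monic) (hM : 1 ≤ P.natDegree) {r : ℂ} (hr : P.IsRoot r)
    (hr1 : P.derivative.eval r ≠ 0) {θ : ℂ} (hθ : θ ≠ 0)
    {W : Set (Fin (2 + 1) ⊕ Fin (2 + 1) → ℂ)}
    (hW : IsIrreducibleClosed ℂ W) (hne : (W ∩ torusLocus ℂ (2 + 1)).Nonempty)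
    (hdim : zariskiDim ℂ W = (2 + 1 : ℕ))
    (hfib : zariskiDim ℂ (matrixAct (dropLastMat 2) '' (W ∩ torusLocus ℂ (2 + 1))) = (2 : ℕ))
    (hproj : zeroLocus ℂ (vanishingIdeal ℂ
      ((fun (w : Fin (2 + 1) ⊕ Fin (2 + 1) → ℂ) (t : Fin 2 ⊕ Fin 2) =>
        w (Sum.map Fin.castSucc Fin.castSucc t)) '' (W ∩ torusLocus ℂ (2 + 1)))) =
      {w : Fin 2 ⊕ Fin 2 → ℂ |
        w (Sum.inl 1) ^ k - P.eval (w (Sum.inl 0)) = 0 ∧ w (Sum.inr 0) = θ}) :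
    (W ∩ expGraph ℂ (2 + 1)).Nonempty := by
  refine inter_expGraph_nonempty_of_unprojectedDense_proj hW hne hdim hfib ?_
  rw [hproj]
  exact (unprojectedDensityQuestion_superelliptic_constFibre_all P hk hP hM hr hr1 hθ).2

/-- **Members of `EC(3,2)` over the cylinders `y₀ = R(x₀)`** (`k ≥ 2`, `P` monic of degree `≥ 1`
with a simple root, `deg P ≠ k ∨ k ≥ 3`, `R` non-constant). [cite: MantovaMasser2023, §1 Further
remarks, p. 5] (new) -/
theorem inter_expGraph_nonempty_of_fibred_over_superelliptic_polyFibre_x₀ (R : Polynomial ℂ)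
    (hR : 1 ≤ R.natDegree) {k : ℕ} (hk : 2 ≤ k) (hP : P.Monic) (hM : 1 ≤ P.natDegree) {r : ℂ}
    (hr : P.IsRoot r) (hr1 : P.derivative.eval r ≠ 0) (hexc : P.natDegree ≠ k ∨ 3 ≤ k)
    {W : Set (Fin (2 + 1) ⊕ Fin (2 + 1) → ℂ)}
    (hW : IsIrreducibleClosed ℂ W) (hne : (W ∩ torusLocus ℂ (2 + 1)).Nonempty)
    (hdim : zariskiDim ℂ W = (2 + 1 : ℕ))
    (hfib : zariskiDim ℂ (matrixAct (dropLastMat 2) '' (W ∩ torusLocus ℂ (2 + 1))) = (2 : ℕ))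
    (hproj : zeroLocus ℂ (vanishingIdeal ℂ
      ((fun (w : Fin (2 + 1) ⊕ Fin (2 + 1) → ℂ) (t : Fin 2 ⊕ Fin 2) =>
        w (Sum.map Fin.castSucc Fin.castSucc t)) '' (W ∩ torusLocus ℂ (2 + 1)))) =
      {w : Fin 2 ⊕ Fin 2 → ℂ |
        w (Sum.inl 1) ^ k - P.eval (w (Sum.inl 0)) = 0 ∧ w (Sum.inr 0) = R.eval (w (Sum.inl 0))}) :
    (W ∩ expGraph ℂ (2 + 1)).Nonempty := by
  refine inter_expGraph_nonempty_of_unprojectedDense_proj hW hne hdim hfib ?_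
  rw [hproj]
  exact (unprojectedDensityQuestion_superelliptic_polyFibre_x₀ P R hR hk hP hM hr hr1 hexc).2

/-- **Members of `EC(3,2)` over the cylinders `y₀ = R(x₁)`** (same hypotheses).
[cite: MantovaMasser2023, §1 Further remarks, p. 5] (new) -/
theorem inter_expGraph_nonempty_of_fibred_over_superelliptic_polyFibre_x₁ (R : Polynomial ℂ)
    (hR : 1 ≤ R.natDegree) {k : ℕ} (hk : 2 ≤ k) (hP : P.Monic) (hM : 1 ≤ P.natDegree) {r : ℂ}
    (hr : P.IsRoot r) (hr1 : P.derivative.eval r ≠ 0) (hexc : P.natDegree ≠ k ∨ 3 ≤ k)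
    {W : Set (Fin (2 + 1) ⊕ Fin (2 + 1) → ℂ)}
    (hW : IsIrreducibleClosed ℂ W) (hne : (W ∩ torusLocus ℂ (2 + 1)).Nonempty)
    (hdim : zariskiDim ℂ W = (2 + 1 : ℕ))
    (hfib : zariskiDim ℂ (matrixAct (dropLastMat 2) '' (W ∩ torusLocus ℂ (2 + 1))) = (2 : ℕ))
    (hproj : zeroLocus ℂ (vanishingIdeal ℂ
      ((fun (w : Fin (2 + 1) ⊕ Fin (2 + 1) → ℂ) (t : Fin 2 ⊕ Fin 2) =>
        w (Sum.map Fin.castSucc Fin.castSucc t)) '' (W ∩ torusLocus ℂ (2 + 1)))) =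
      {w : Fin 2 ⊕ Fin 2 → ℂ |
        w (Sum.inl 1) ^ k - P.eval (w (Sum.inl 0)) = 0 ∧ w (Sum.inr 0) = R.eval (w (Sum.inl 1))}) :
    (W ∩ expGraph ℂ (2 + 1)).Nonempty := by
  refine inter_expGraph_nonempty_of_unprojectedDense_proj hW hne hdim hfib ?_
  rw [hproj]
  exact (unprojectedDensityQuestion_superelliptic_polyFibre_x₁ P R hR hk hP hM hr hr1 hexc).2

end Superelliptic

end Summit.Schanuel.Schanuel.Theorems

end
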